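import Literature.Probability.Percolation.FKLoopWindingCells

/-!
# Stub `s17_strandTurning` of line `rainbow-monomials-in-excursion-kernels` — Part 2:
# the difference of the partial winding numbers of two strands between the same ends
# (crux `BoundaryDefectGaussianR`, stmt-CriticalPhenomena-14132; insertion dictionary D2, T6)

Model-free winding bookkeeping for T6. For two dart paths `P 0 → P 1 → ⋯ → P n` and
`P' 0 → ⋯ → P' n'` of the oriented medial graph (`MedialTrail.IsDart`) with the same initial and the
same final vertex, the difference `Δ F = dwnd D F - dwnd D' F` of their partial winding numbers
(`MedialTrail.dwnd`, horizontal-ray count of `MedialTrailUmlaufsatz`) behaves like the winding number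
of the closed polygon `D - D'`:

* `s17_st2_dwnd_eq_zero_of_lt` — it vanishes on faces west of every dart;
* `s17_st2_jump` — it does not jump across a dart of the graph lying on neither path (vertical
  darts: `dwnd_sub_west`; horizontal darts: the flux identity `dwnd_sub_south_add`, the boundary
  terms of the two open paths cancelling because the endpoints agree, `s17_st2_telescope`);
* `s17_strandTurning_part2` (registered) — hence it vanishes on every face joined to a far western
  face by a chain of faces, consecutive ones being the two sides of a dart on neither path;
* `s17_st2_side` — the common side of two edge-adjacent squares of the medial lattice is the dart
  of a corner (`cornerDart`), with the two squares on its two sides.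

Everything is proved; no new definitions.
-/

namespace Summit.CriticalPhenomena.CardyFormulaZ2.Cruxes.BoundaryDefectGaussianR.RainbowMonomialsInExcursionKernels

open Literature.Probability.LatticeModels Literature.Probability.LatticeModels.MedialTrail
open Literature.Probability.Percolation

/-- A dart list contributes nothing to a face west of all its darts. [folklore] -/
theorem s17_st2_dwnd_eq_zero_of_lt (D : List (Pt × Pt)) (F : Pt) (h : ∀ d ∈ D, F.1 < d.1.1) : dwnd D F = 0 := by
  induction D with
  | nil => rfl
  | cons d D ih =>
    rw [dwnd_cons, dartWnd_eq_zero_of_lt d F (h d (by simp)), ih (fun d' hd' => h d' (by simp [hd'])), add_zero]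

/-- Telescoping along the darts of a path. [folklore] -/
theorem s17_st2_telescope (P : ℕ → Pt) (g : Pt → ℤ) : ∀ n : ℕ,
    (((List.range n).map (fun m => (P m, P (m + 1)))).map (fun d => g d.2 - g d.1)).sum = g (P n) - g (P 0)
  | 0 => by simp
  | n + 1 => by
    rw [List.range_succ, List.map_append, List.map_append, List.sum_append, s17_st2_telescope P g n]
    simp only [List.map_cons, List.map_nil, List.sum_cons, List.sum_nil]
    ring

/-- The darts of a dart path are darts. [folklore] -/
theorem s17_st2_darts (P : ℕ → Pt) (n : ℕ) (hD : ∀ m < n, IsDart (P m) (P (m + 1))) :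
    ∀ d ∈ (List.range n).map (fun m => (P m, P (m + 1))), IsDart d.1 d.2 := by
  intro d hd
  rw [List.mem_map] at hd
  obtain ⟨m, hm, rfl⟩ := hd
  exact hD m (List.mem_range.1 hm)

/-- **No jump across a dart on neither path.** For two dart paths with the same initial and the
same final vertex, the difference of their partial winding numbers takes the same value on the two
faces beside any dart of the oriented medial graph lying on neither path. [folklore] -/
theorem s17_st2_jump (P P' : ℕ → Pt) (n n' : ℕ) (h0 : P 0 = P' 0) (hn : P n = P' n')
    (hD : ∀ m < n, IsDart (P m) (P (m + 1))) (hD' : ∀ m < n', IsDart (P' m) (P' (m + 1)))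
    {s : Pt × Pt} (hs : IsDart s.1 s.2)
    (hsA : s ∉ (List.range n).map (fun m => (P m, P (m + 1))))
    (hsB : s ∉ (List.range n').map (fun m => (P' m, P' (m + 1)))) :
    dwnd ((List.range n).map (fun m => (P m, P (m + 1)))) (lf s) -
        dwnd ((List.range n').map (fun m => (P' m, P' (m + 1)))) (lf s) =
      dwnd ((List.range n).map (fun m => (P m, P (m + 1)))) (rf s) -
        dwnd ((List.range n').map (fun m => (P' m, P' (m + 1)))) (rf s) := by
  set DA := (List.range n).map (fun m => (P m, P (m + 1))) with hDA
  set DB := (List.range n').map (fun m => (P' m, P' (m + 1))) with hDB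
  have hdA : ∀ d ∈ DA, IsDart d.1 d.2 := s17_st2_darts P n hD
  have hdB : ∀ d ∈ DB, IsDart d.1 d.2 := s17_st2_darts P' n' hD'
  have tA : ∀ g : Pt → ℤ, (DA.map (fun d => g d.2 - g d.1)).sum = g (P n) - g (P 0) := fun g =>
    s17_st2_telescope P g n
  have tB : ∀ g : Pt → ℤ, (DB.map (fun d => g d.2 - g d.1)).sum = g (P n) - g (P 0) := fun g => by
    rw [h0, hn]; exact s17_st2_telescope P' g n'
  have cA : DA.count s = 0 := List.count_eq_zero_of_not_mem hsA
  have cB : DB.count s = 0 := List.count_eq_zero_of_not_mem hsB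
  have cA' : DA.count s.swap = 0 := List.count_eq_zero_of_not_mem fun h => (hdA _ h).not_swap hs
  have cB' : DB.count s.swap = 0 := List.count_eq_zero_of_not_mem fun h => (hdB _ h).not_swap hs
  obtain ⟨a, b, rfl | rfl | rfl | rfl⟩ := hs.cases <;> simp only [Prod.swap_prod_mk] at cA cB cA' cB'
  · -- north
    have h1 := dwnd_sub_west DA a b
    have h2 := dwnd_sub_west DB a b
    rw [cA, cA'] at h1
    rw [cB, cB'] at h2
    rw [lf_north, rf_north]
    push_cast at h1 h2
    linarith
  · -- south
    have h1 := dwnd_sub_west DA a (b - 1)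
    have h2 := dwnd_sub_west DB a (b - 1)
    simp only [sub_add_cancel] at h1 h2
    rw [cA, cA'] at h1
    rw [cB, cB'] at h2
    rw [lf_south, rf_south]
    push_cast at h1 h2
    linarith
  · -- east
    have h1 := dwnd_sub_south_add DA hdA a b
    have h2 := dwnd_sub_south_add DB hdB a b
    rw [cA, cA', tA] at h1
    rw [cB, cB', tB] at h2
    rw [lf_east, rf_east]
    push_cast at h1 h2
    linarith
  · -- west
    have h1 := dwnd_sub_south_add DA hdA (a - 1) b
    have h2 := dwnd_sub_south_add DB hdB (a - 1) b
    simp only [sub_add_cancel] at h1 h2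
    rw [cA, cA', tA] at h1
    rw [cB, cB', tB] at h2
    rw [lf_west, rf_west]
    push_cast at h1 h2
    linarith

/-- **Constancy along chains.** The difference of the partial winding numbers of two dart paths
between the same ends takes the same value on two faces joined by a chain of faces, consecutive
ones being the two sides of a dart of the graph lying on neither path. [folklore] -/
theorem s17_st2_const (P P' : ℕ → Pt) (n n' : ℕ) (h0 : P 0 = P' 0) (hn : P n = P' n')
    (hD : ∀ m < n, IsDart (P m) (P (m + 1))) (hD' : ∀ m < n', IsDart (P' m) (P' (m + 1))) {F F' : Pt}
    (hchain : Relation.ReflTransGen (fun G G' : Pt => ∃ s : Pt × Pt, IsDart s.1 s.2 ∧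
      s ∉ (List.range n).map (fun m => (P m, P (m + 1))) ∧ s ∉ (List.range n').map (fun m => (P' m, P' (m + 1))) ∧
      ((lf s = G ∧ rf s = G') ∨ (lf s = G' ∧ rf s = G))) F F') :
    dwnd ((List.range n).map (fun m => (P m, P (m + 1)))) F - dwnd ((List.range n').map (fun m => (P' m, P' (m + 1)))) F =
      dwnd ((List.range n).map (fun m => (P m, P (m + 1)))) F' - dwnd ((List.range n').map (fun m => (P' m, P' (m + 1)))) F' := by
  induction hchain with
  | refl => rfl
  | tail _ hst ih =>
    obtain ⟨s, hs, hsA, hsB, h⟩ := hst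
    have hj := s17_st2_jump P P' n n' h0 hn hD hD' hs hsA hsB
    rcases h with ⟨rfl, rfl⟩ | ⟨rfl, rfl⟩
    · rw [ih, hj]
    · rw [ih, ← hj]

/-- **Registered sub-goal `s17_strandTurning_part2`: the difference of the partial winding numbers
of two dart paths between the same ends vanishes on every face chained to a far western face.**
For two paths of darts of the oriented medial graph with the same initial and the same final vertex,
let `Δ F` be the difference of the winding contributions (`MedialTrail.dwnd`) of their dart lists at
the face `F`. If `F` is joined to a face `F'` lying west of every dart of both paths by a chain of
faces in which consecutive faces are the left and right faces of a dart of the graph lying on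
neither path, then `Δ F = 0` (no jump across such darts; vanishing far west). [folklore] -/
theorem s17_strandTurning_part2 : ∀ (P P' : ℕ → ℤ × ℤ) (n n' : ℕ), P 0 = P' 0 → P n = P' n' → (∀ m < n, Literature.Probability.LatticeModels.MedialTrail.IsDart (P m) (P (m + 1))) → (∀ m < n', Literature.Probability.LatticeModels.MedialTrail.IsDart (P' m) (P' (m + 1))) → ∀ (F F' : ℤ × ℤ), Relation.ReflTransGen (fun G G' : ℤ × ℤ => ∃ s : (ℤ × ℤ) × (ℤ × ℤ), Literature.Probability.LatticeModels.MedialTrail.IsDart s.1 s.2 ∧ s ∉ (List.range n).map (fun m => (P m, P (m + 1))) ∧ s ∉ (List.range n').map (fun m => (P' m, P' (m + 1))) ∧ ((Literature.Probability.LatticeModels.MedialTrail.lf s = G ∧ Literature.Probability.LatticeModels.MedialTrail.rf s = G') ∨ (Literature.Probability.LatticeModels.MedialTrail.lf s = G' ∧ Literature.Probability.LatticeModels.MedialTrail.rf s = G))) F F' → (∀ m ≤ n, F'.1 < (P m).1) → (∀ m ≤ n', F'.1 < (P' m).1) → Literature.Probability.LatticeModels.MedialTrail.dwnd ((List.range n).map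 (fun m => (P m, P (m + 1)))) F - Literature.Probability.LatticeModels.MedialTrail.dwnd ((List.range n').map (fun m => (P' m, P' (m + 1)))) F = 0 := by
  intro P P' n n' h0 hn hD hD' F F' hchain hfar hfar'
  rw [s17_st2_const P P' n n' h0 hn hD hD' hchain, s17_st2_dwnd_eq_zero_of_lt _ _ fun d hd => ?_,
    s17_st2_dwnd_eq_zero_of_lt _ _ fun d hd => ?_, sub_zero]
  · rw [List.mem_map] at hd
    obtain ⟨m, hm, rfl⟩ := hd
    exact hfar' m (List.mem_range.1 hm).le
  · rw [List.mem_map] at hd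
    obtain ⟨m, hm, rfl⟩ := hd
    exact hfar m (List.mem_range.1 hm).le

/-! ### Sides of squares are darts of corners -/

/-- **The side shared by a square and its translate by a unit vector is the dart of a corner**,
with the two squares on its two sides. [folklore] -/
theorem s17_st2_side (o : Fin 2 → ℤ) (j : Fin 4) :
    ∃ c : Site 2 × Fin 4,
      (lf (cornerDart c) = (o 0, o 1) ∧ rf (cornerDart c) = ((o + cornerUnit j) 0, (o + cornerUnit j) 1)) ∨
      (lf (cornerDart c) = ((o + cornerUnit j) 0, (o + cornerUnit j) 1) ∧ rf (cornerDart c) = (o 0, o 1)) := by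
  rcases exists_vcell_or_fcell (o 0, o 1) with ⟨v, hv⟩ | ⟨f, hf⟩
  · -- a vertex square: its sides are the darts of the corners at `v`, square on the left
    have h0 : o 0 = v 0 + v 1 - 1 := by have := congrArg Prod.fst hv; simpa [vcell] using this
    have h1 : o 1 = v 1 - v 0 := by have := congrArg Prod.snd hv; simpa [vcell] using this
    have side : ∀ k : Fin 4, rf (cornerDart (v, k)) = ((o + cornerUnit (![0, 1, 2, 3] k)) 0, (o + cornerUnit (![0, 1, 2, 3] k)) 1) →
        ∃ c : Site 2 × Fin 4,
          (lf (cornerDart c) = (o 0, o 1) ∧ rf (cornerDart c) = ((o + cornerUnit (![0, 1, 2, 3] k)) 0, (o + cornerUnit (![0, 1, 2, 3] k)) 1)) ∨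
          (lf (cornerDart c) = ((o + cornerUnit (![0, 1, 2, 3] k)) 0, (o + cornerUnit (![0, 1, 2, 3] k)) 1) ∧
            rf (cornerDart c) = (o 0, o 1)) :=
      fun k hk => ⟨(v, k), Or.inl ⟨by rw [lf_cornerDart, hv], hk⟩⟩
    fin_cases j
    · refine side 0 (Prod.ext ?_ ?_) <;> simp [rf_cornerDart, fcell, cFace, faceAt, cornerOff, cornerUnit] <;> omega
    · refine side 1 (Prod.ext ?_ ?_) <;> simp [rf_cornerDart, fcell, cFace, faceAt, cornerOff, cornerUnit] <;> omega
    · refine side 2 (Prod.ext ?_ ?_) <;> simp [rf_cornerDart, fcell, cFace, faceAt, cornerOff, cornerUnit] <;> omega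
    · refine side 3 (Prod.ext ?_ ?_) <;> simp [rf_cornerDart, fcell, cFace, faceAt, cornerOff, cornerUnit] <;> omega
  · -- a face square: its sides are the darts of the corners of the face, square on the right
    have h0 : o 0 = f 0 + f 1 := by have := congrArg Prod.fst hf; simpa [fcell] using this
    have h1 : o 1 = f 1 - f 0 := by have := congrArg Prod.snd hf; simpa [fcell] using this
    have key : ∀ k : Fin 4, rf (cornerDart (f + cornerOff k, k)) = (o 0, o 1) := by
      intro k
      rw [hf, rf_cornerDart, cFace]
      simp only [faceAt, add_sub_cancel_right]
    have side : ∀ k : Fin 4, lf (cornerDart (f + cornerOff k, k)) =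
        ((o + cornerUnit (![2, 3, 0, 1] k)) 0, (o + cornerUnit (![2, 3, 0, 1] k)) 1) →
        ∃ c : Site 2 × Fin 4,
          (lf (cornerDart c) = (o 0, o 1) ∧ rf (cornerDart c) = ((o + cornerUnit (![2, 3, 0, 1] k)) 0, (o + cornerUnit (![2, 3, 0, 1] k)) 1)) ∨
          (lf (cornerDart c) = ((o + cornerUnit (![2, 3, 0, 1] k)) 0, (o + cornerUnit (![2, 3, 0, 1] k)) 1) ∧
            rf (cornerDart c) = (o 0, o 1)) :=
      fun k hk => ⟨(f + cornerOff k, k), Or.inr ⟨hk, key k⟩⟩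
    fin_cases j
    · refine side 2 (Prod.ext ?_ ?_) <;> simp [lf_cornerDart, vcell, cornerOff, cornerUnit] <;> omega
    · refine side 3 (Prod.ext ?_ ?_) <;> simp [lf_cornerDart, vcell, cornerOff, cornerUnit] <;> omega
    · refine side 0 (Prod.ext ?_ ?_) <;> simp [lf_cornerDart, vcell, cornerOff, cornerUnit] <;> omega
    · refine side 1 (Prod.ext ?_ ?_) <;> simp [lf_cornerDart, vcell, cornerOff, cornerUnit] <;> omega

end Summit.CriticalPhenomena.CardyFormulaZ2.Cruxes.BoundaryDefectGaussianR.RainbowMonomialsInExcursionKernels
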